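import Literature.Topology.FourManifolds.CuspWhitneyData
import Literature.Topology.FourManifolds.FoldChartSigPoint
import HarnessLib

/-!
# Cusps are isolated: near a point with Whitney cusp data every other critical point is a fold

Topic `Literature/Topology/FourManifolds` (programme of the fact
`Literature.Topology.FourManifolds.exists_isSimplifiedBrokenLefschetzFibration`, Baykur–Saeki 2017, §2.1:
a generic map `X⁴ → Σ²` has folds along circles and finitely many cusps).  Let `F : ℝ⁴ → ℝ²`
have Whitney cusp data at `p` (`HasWhitneyCuspData`: centred charts with
`F = (t, h(t, x) + ε₂ y² + ε₃ z²)`, `h = hₜ = hₓ = hₓₓ = 0`, `hₓₓₓ ≠ 0`, `hₜₓ ≠ 0` at `0`).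
Then on a punctured neighbourhood of `p` every critical point of `F` is a fold point
(`OneJet.IsFoldPointAt`).  Indeed the critical points of the model are `{hₓ = 0, y = z = 0}`,
such a point is a fold point iff `hₓₓ ≠ 0` there, and the map `Θ = (hₓ, hₓₓ)` of the plane has
invertible differential at `0` (`det = hₜₓ hₓₓₓ ≠ 0`), so `hₓ = hₓₓ = 0` only at `0` near `0`
(inverse function theorem).  Consequently the cusps of a generic map are isolated
(Golubitsky–Guillemin VI §2; used by Baykur–Saeki §2.1, "finitely many cusps").

* `eventually_eq_zero_of_whitney` — the planar statement about `Θ = (hₓ, hₓₓ)`;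
* `critical_cuspModel_iff`, `isFoldPointAt_cuspModel` — criticality and the fold condition for
  the split model at nearby points;
* `HasWhitneyCuspData.eventually_isFoldPointAt` — the punctured-neighbourhood statement.

Everything is proved; no definitions, no named facts (D-0026).

## References

* M. Golubitsky, V. Guillemin, *Stable Mappings and Their Singularities*, GTM 14 (1973), Ch. VI
  §2 (cusps of maps of the plane), Thm. 2.4 and its proof. [GolubitskyGuillemin1973]
* R. İ. Baykur, O. Saeki, *Simplifying indefinite fibrations on 4-manifolds*, arXiv:1705.11169,
  §2.1, p. 6. [BaykurSaeki2017]
-/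

noncomputable section

set_option maxSynthPendingDepth 2

open Set Function Filter Module
open scoped ContDiff Topology

namespace Literature.Topology.FourManifolds

/-- Local notation: `𝔼 n` is the model Euclidean space `EuclideanSpace ℝ (Fin n)`. -/
local notation "𝔼 " n:arg => EuclideanSpace ℝ (Fin n)

/-! ### The planar lemma: `hₓ = hₓₓ = 0` only at the cusp -/

/-- `2 ≤ ∞` and `3 ≤ ∞` in `WithTop ℕ∞`. [folklore] -/
private theorem coe_le_infty (n : ℕ) : ((n : ℕ∞) : WithTop ℕ∞) ≤ ∞ := WithTop.coe_le_coe.2 le_top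

/-- Decomposition of a vector of the plane along the coordinate axes. [folklore] -/
private theorem prod_eq_smul_add_smul (v : ℝ × ℝ) :
    v = v.1 • ((1 : ℝ), (0 : ℝ)) + v.2 • ((0 : ℝ), (1 : ℝ)) := by
  ext <;> simp

/-- **`hₓ = hₓₓ = 0` only at the cusp.**  If `h` is `C^∞` near `0` with `hₓₓ(0) = 0`,
`hₓₓₓ(0) ≠ 0` and `hₜₓ(0) ≠ 0`, then near `0` the only common zero of `hₓ` and `hₓₓ` is `0`:
the map `Θ = (hₓ, hₓₓ)` has invertible (triangular) differential at `0`, hence is injective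
near `0` by the inverse function theorem. [cite: GolubitskyGuillemin1973, Ch. VI §2] -/
theorem eventually_eq_zero_of_whitney {h : ℝ × ℝ → ℝ} {U : Set (ℝ × ℝ)} (hU : IsOpen U)
    (h0 : (0 : ℝ × ℝ) ∈ U) (hh : ContDiffOn ℝ ∞ h U) (hx : fderiv ℝ h 0 ((0 : ℝ), (1 : ℝ)) = 0)
    (hxx : fderiv ℝ (fderiv ℝ h) 0 ((0 : ℝ), (1 : ℝ)) ((0 : ℝ), (1 : ℝ)) = 0)
    (hxxx : fderiv ℝ (fderiv ℝ (fderiv ℝ h)) 0 ((0 : ℝ), (1 : ℝ)) ((0 : ℝ), (1 : ℝ))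
      ((0 : ℝ), (1 : ℝ)) ≠ 0)
    (htx : fderiv ℝ (fderiv ℝ h) 0 ((1 : ℝ), (0 : ℝ)) ((0 : ℝ), (1 : ℝ)) ≠ 0) :
    ∀ᶠ q in 𝓝 (0 : ℝ × ℝ), fderiv ℝ h q ((0 : ℝ), (1 : ℝ)) = 0 →
      fderiv ℝ (fderiv ℝ h) q ((0 : ℝ), (1 : ℝ)) ((0 : ℝ), (1 : ℝ)) = 0 → q = 0 := by
  set e : ℝ × ℝ := ((0 : ℝ), (1 : ℝ)) with he
  set Θ : ℝ × ℝ → ℝ × ℝ := fun q => (fderiv ℝ h q e, fderiv ℝ (fderiv ℝ h) q e e) with hΘ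
  -- smoothness of the first and second derivative near `0`
  have hd1 : ContDiffOn ℝ ∞ (fderiv ℝ h) U := hh.fderiv_of_isOpen hU (by simp)
  have hd2 : ContDiffOn ℝ ∞ (fderiv ℝ (fderiv ℝ h)) U := hd1.fderiv_of_isOpen hU (by simp)
  have hΘs : ContDiffOn ℝ ∞ Θ U :=
    (hd1.clm_apply contDiffOn_const).prodMk ((hd2.clm_apply contDiffOn_const).clm_apply
      contDiffOn_const)
  have hΘc : ContDiffAt ℝ ∞ Θ 0 := hΘs.contDiffAt (hU.mem_nhds h0)
  -- the differential of `Θ` at `0`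
  have hD1 : HasFDerivAt (fderiv ℝ h) (fderiv ℝ (fderiv ℝ h) 0) 0 :=
    ((hd1.contDiffAt (hU.mem_nhds h0)).differentiableAt (by simp)).hasFDerivAt
  have hD2 : HasFDerivAt (fderiv ℝ (fderiv ℝ h)) (fderiv ℝ (fderiv ℝ (fderiv ℝ h)) 0) 0 :=
    ((hd2.contDiffAt (hU.mem_nhds h0)).differentiableAt (by simp)).hasFDerivAt
  set T₁ : ℝ × ℝ →L[ℝ] ℝ :=
    (ContinuousLinearMap.apply ℝ ℝ e).comp (fderiv ℝ (fderiv ℝ h) 0) with hT₁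
  set T₂ : ℝ × ℝ →L[ℝ] ℝ :=
    ((ContinuousLinearMap.apply ℝ ℝ e).comp (ContinuousLinearMap.apply ℝ (ℝ × ℝ →L[ℝ] ℝ) e)).comp
      (fderiv ℝ (fderiv ℝ (fderiv ℝ h)) 0) with hT₂
  have hΘ1 : HasFDerivAt (fun q => fderiv ℝ h q e) T₁ 0 :=
    (ContinuousLinearMap.apply ℝ ℝ e).hasFDerivAt.comp 0 hD1
  have hΘ2 : HasFDerivAt (fun q => fderiv ℝ (fderiv ℝ h) q e e) T₂ 0 :=
    ((ContinuousLinearMap.apply ℝ ℝ e).comp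
      (ContinuousLinearMap.apply ℝ (ℝ × ℝ →L[ℝ] ℝ) e)).hasFDerivAt.comp 0 hD2
  have hΘd : HasFDerivAt Θ (T₁.prod T₂) 0 := hΘ1.prodMk hΘ2
  have hT₁v : ∀ v, T₁ v = fderiv ℝ (fderiv ℝ h) 0 v e := fun v => by simp [hT₁]
  have hT₂v : ∀ v, T₂ v = fderiv ℝ (fderiv ℝ (fderiv ℝ h)) 0 v e e := fun v => by simp [hT₂]
  -- it is injective (lower triangular with non-zero diagonal)
  have hinj : Injective (T₁.prod T₂) := by
    intro v w hvw
    rw [← sub_eq_zero] at hvw ⊢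
    rw [← map_sub] at hvw
    set u := v - w with hu
    have h1 : T₁ u = 0 := by simpa using congrArg Prod.fst hvw
    have h2 : T₂ u = 0 := by simpa using congrArg Prod.snd hvw
    rw [hT₁v, prod_eq_smul_add_smul u, map_add, map_smul, map_smul] at h1
    rw [hT₂v, prod_eq_smul_add_smul u, map_add, map_smul, map_smul] at h2
    simp only [_root_.add_apply, _root_.smul_apply, smul_eq_mul, ← he, hxx, mul_zero,
      add_zero] at h1
    have hu1 : u.1 = 0 := (mul_eq_zero.1 h1).resolve_right htx
    simp only [hu1, zero_smul, zero_add, _root_.smul_apply, smul_eq_mul] at h2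
    have hu2 : u.2 = 0 := (mul_eq_zero.1 h2).resolve_right hxxx
    exact Prod.ext hu1 hu2
  -- hence invertible; inverse function theorem
  set L : (ℝ × ℝ) ≃L[ℝ] ℝ × ℝ :=
    (LinearMap.linearEquivOfInjective ((T₁.prod T₂ : ℝ × ℝ →L[ℝ] ℝ × ℝ) : ℝ × ℝ →ₗ[ℝ] ℝ × ℝ)
      hinj rfl).toContinuousLinearEquiv with hL
  have hLc : (L : ℝ × ℝ →L[ℝ] ℝ × ℝ) = T₁.prod T₂ := ContinuousLinearMap.ext fun _ => rfl
  have hΘstrict : HasStrictFDerivAt Θ (L : ℝ × ℝ →L[ℝ] ℝ × ℝ) 0 := by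
    have h := hΘc.hasStrictFDerivAt (by simp)
    rw [hΘd.fderiv] at h
    rwa [hLc]
  set Φ := hΘstrict.toOpenPartialHomeomorph Θ with hΦ
  have h0Φ : (0 : ℝ × ℝ) ∈ Φ.source := hΘstrict.mem_toOpenPartialHomeomorph_source
  have hΦΘ : ∀ q, Φ q = Θ q := fun q => rfl
  filter_upwards [Φ.open_source.mem_nhds h0Φ] with q hq h1 h2
  have hΘq : Θ q = Θ 0 := by
    change (fderiv ℝ h q e, fderiv ℝ (fderiv ℝ h) q e e) = (fderiv ℝ h 0 e, fderiv ℝ (fderiv ℝ h) 0 e e)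
    rw [h1, h2, he, hx, hxx]
  exact Φ.injOn hq h0Φ (by rw [hΦΘ, hΦΘ, hΘq])

/-! ### The split cusp model at nearby points -/

section Evaluations

variable {h : ℝ × ℝ → ℝ} {U : Set (ℝ × ℝ)} {ε₂ ε₃ : ℝ} {y : 𝔼 4}

/-- `dG_y(e₁) = hₓ(y₀, y₁)` for the split cusp model. [folklore] -/
private theorem dfm_single_one (hU : IsOpen U) (hh : ContDiffOn ℝ ∞ h U)
    (hy : y ∈ OneJet.baseProj ⁻¹' U) :
    fderiv ℝ (OneJet.cuspModelFn h ε₂ ε₃) y (EuclideanSpace.single (1 : Fin 4) (1 : ℝ)) =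
      fderiv ℝ h (y 0, y 1) ((0 : ℝ), (1 : ℝ)) := by
  rw [OneJet.fderiv_cuspModelFn_apply hU hh hy]
  simp

/-- `dG_y(e₂) = 2 ε₂ y₂`. [folklore] -/
private theorem dfm_single_two (hU : IsOpen U) (hh : ContDiffOn ℝ ∞ h U)
    (hy : y ∈ OneJet.baseProj ⁻¹' U) :
    fderiv ℝ (OneJet.cuspModelFn h ε₂ ε₃) y (EuclideanSpace.single (2 : Fin 4) (1 : ℝ)) =
      2 * ε₂ * y 2 := by
  rw [OneJet.fderiv_cuspModelFn_apply hU hh hy]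
  simp [Prod.mk_zero_zero]

/-- `dG_y(e₃) = 2 ε₃ y₃`. [folklore] -/
private theorem dfm_single_three (hU : IsOpen U) (hh : ContDiffOn ℝ ∞ h U)
    (hy : y ∈ OneJet.baseProj ⁻¹' U) :
    fderiv ℝ (OneJet.cuspModelFn h ε₂ ε₃) y (EuclideanSpace.single (3 : Fin 4) (1 : ℝ)) =
      2 * ε₃ * y 3 := by
  rw [OneJet.fderiv_cuspModelFn_apply hU hh hy]
  simp [Prod.mk_zero_zero]

/-- `D²G_y(e₁, k) = D²h(y₀,y₁)((0,1),(k₀,k₁))`. [folklore] -/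
private theorem d2fm_single_one (hU : IsOpen U) (hh : ContDiffOn ℝ ∞ h U)
    (hy : y ∈ OneJet.baseProj ⁻¹' U) (k : 𝔼 4) :
    fderiv ℝ (fderiv ℝ (OneJet.cuspModelFn h ε₂ ε₃)) y (EuclideanSpace.single (1 : Fin 4) (1 : ℝ)) k
      = fderiv ℝ (fderiv ℝ h) (y 0, y 1) ((0 : ℝ), (1 : ℝ)) (k 0, k 1) := by
  rw [OneJet.fderiv_fderiv_cuspModelFn_apply hU hh hy]
  simp

/-- `D²G_y(e₂, k) = 2 ε₂ k₂`. [folklore] -/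
private theorem d2fm_single_two (hU : IsOpen U) (hh : ContDiffOn ℝ ∞ h U)
    (hy : y ∈ OneJet.baseProj ⁻¹' U) (k : 𝔼 4) :
    fderiv ℝ (fderiv ℝ (OneJet.cuspModelFn h ε₂ ε₃)) y (EuclideanSpace.single (2 : Fin 4) (1 : ℝ)) k
      = 2 * ε₂ * k 2 := by
  rw [OneJet.fderiv_fderiv_cuspModelFn_apply hU hh hy]
  simp [Prod.mk_zero_zero]

/-- `D²G_y(e₃, k) = 2 ε₃ k₃`. [folklore] -/
private theorem d2fm_single_three (hU : IsOpen U) (hh : ContDiffOn ℝ ∞ h U)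
    (hy : y ∈ OneJet.baseProj ⁻¹' U) (k : 𝔼 4) :
    fderiv ℝ (fderiv ℝ (OneJet.cuspModelFn h ε₂ ε₃)) y (EuclideanSpace.single (3 : Fin 4) (1 : ℝ)) k
      = 2 * ε₃ * k 3 := by
  rw [OneJet.fderiv_fderiv_cuspModelFn_apply hU hh hy]
  simp [Prod.mk_zero_zero]

end Evaluations

/-- **Critical points of the split cusp model** `G = (t, h(t,x) + ε₂y² + ε₃z²)`: `dG_y` is not
onto iff `hₓ(y₀, y₁) = 0`, `ε₂ y₂ = 0` and `ε₃ y₃ = 0`. [cite: GolubitskyGuillemin1973, Ch. VI §2] -/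
theorem critical_cuspModel_iff {h : ℝ × ℝ → ℝ} {U : Set (ℝ × ℝ)} (hU : IsOpen U)
    (hh : ContDiffOn ℝ ∞ h U) {ε₂ ε₃ : ℝ} {y : 𝔼 4} (hy : y ∈ OneJet.baseProj ⁻¹' U) :
    ¬ Surjective (fderiv ℝ (OneJet.rankOneMap (OneJet.cuspModelFn h ε₂ ε₃)) y) ↔
      fderiv ℝ h (y 0, y 1) ((0 : ℝ), (1 : ℝ)) = 0 ∧ ε₂ * y 2 = 0 ∧ ε₃ * y 3 = 0 := by
  have hΩ : IsOpen (OneJet.baseProj ⁻¹' U : Set (𝔼 4)) := hU.preimage OneJet.baseProj.continuous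
  have hfd : DifferentiableAt ℝ (OneJet.cuspModelFn h ε₂ ε₃) y :=
    ((OneJet.contDiffOn_cuspModelFn hh ε₂ ε₃).contDiffAt (hΩ.mem_nhds hy)).differentiableAt
      (by simp)
  rw [OneJet.not_surjective_fderiv_rankOneMap_iff hfd]
  constructor
  · intro hc
    have h1 := hc (EuclideanSpace.single (1 : Fin 4) (1 : ℝ)) (by simp)
    have h2 := hc (EuclideanSpace.single (2 : Fin 4) (1 : ℝ)) (by simp)
    have h3 := hc (EuclideanSpace.single (3 : Fin 4) (1 : ℝ)) (by simp)
    rw [dfm_single_one hU hh hy] at h1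
    rw [dfm_single_two hU hh hy] at h2
    rw [dfm_single_three hU hh hy] at h3
    refine ⟨h1, ?_, ?_⟩ <;> linarith
  · rintro ⟨h1, h2, h3⟩ v hv
    rw [OneJet.fderiv_cuspModelFn_apply hU hh hy, hv]
    have hv' : ((0 : ℝ), v 1) = v 1 • ((0 : ℝ), (1 : ℝ)) := by ext <;> simp
    rw [hv', map_smul, h1, smul_zero, zero_add]
    linear_combination (2 * v 2) * h2 + (2 * v 3) * h3

/-- **Fold points of the split cusp model**: a critical point `y` of
`G = (t, h(t,x) + ε₂y² + ε₃z²)` (`εᵢ ≠ 0`) with `hₓₓ(y₀, y₁) ≠ 0` is a fold point.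
[cite: GolubitskyGuillemin1973, Ch. VI §2] -/
theorem isFoldPointAt_cuspModel {h : ℝ × ℝ → ℝ} {U : Set (ℝ × ℝ)} (hU : IsOpen U)
    (hh : ContDiffOn ℝ ∞ h U) {ε₂ ε₃ : ℝ} (hε₂ : ε₂ ≠ 0) (hε₃ : ε₃ ≠ 0) {y : 𝔼 4}
    (hy : y ∈ OneJet.baseProj ⁻¹' U)
    (hcrit : ¬ Surjective (fderiv ℝ (OneJet.rankOneMap (OneJet.cuspModelFn h ε₂ ε₃)) y))
    (hxx : fderiv ℝ (fderiv ℝ h) (y 0, y 1) ((0 : ℝ), (1 : ℝ)) ((0 : ℝ), (1 : ℝ)) ≠ 0) :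
    OneJet.IsFoldPointAt (OneJet.rankOneMap (OneJet.cuspModelFn h ε₂ ε₃)) y := by
  have hΩ : IsOpen (OneJet.baseProj ⁻¹' U : Set (𝔼 4)) := hU.preimage OneJet.baseProj.continuous
  have hfm : ContDiffOn ℝ ∞ (OneJet.cuspModelFn h ε₂ ε₃) (OneJet.baseProj ⁻¹' U) :=
    OneJet.contDiffOn_cuspModelFn hh ε₂ ε₃
  have hfd : DifferentiableAt ℝ (OneJet.cuspModelFn h ε₂ ε₃) y :=
    (hfm.contDiffAt (hΩ.mem_nhds hy)).differentiableAt (by simp)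
  rw [OneJet.isFoldPointAt_rankOneMap_iff hΩ hfm hy]
  refine ⟨(OneJet.not_surjective_fderiv_rankOneMap_iff hfd).1 hcrit, fun k₀ hk₀ hrad => ?_⟩
  have h1 := hrad (EuclideanSpace.single (1 : Fin 4) (1 : ℝ)) (by simp)
  have h2 := hrad (EuclideanSpace.single (2 : Fin 4) (1 : ℝ)) (by simp)
  have h3 := hrad (EuclideanSpace.single (3 : Fin 4) (1 : ℝ)) (by simp)
  rw [d2fm_single_one hU hh hy, hk₀] at h1
  rw [d2fm_single_two hU hh hy] at h2
  rw [d2fm_single_three hU hh hy] at h3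
  have hk' : ((0 : ℝ), k₀ 1) = k₀ 1 • ((0 : ℝ), (1 : ℝ)) := by ext <;> simp
  rw [hk', map_smul, smul_eq_mul] at h1
  have hk1 : k₀ 1 = 0 := (mul_eq_zero.1 h1).resolve_right hxx
  have hk2 : k₀ 2 = 0 := by
    rcases mul_eq_zero.1 h2 with h | h
    · rcases mul_eq_zero.1 h with h' | h'
      · norm_num at h'
      · exact absurd h' hε₂
    · exact h
  have hk3 : k₀ 3 = 0 := by
    rcases mul_eq_zero.1 h3 with h | h
    · rcases mul_eq_zero.1 h with h' | h'
      · norm_num at h'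
      · exact absurd h' hε₃
    · exact h
  ext i
  fin_cases i
  · simpa using hk₀
  · simpa using hk1
  · simpa using hk2
  · simpa using hk3

/-! ### Transfer to a map with Whitney cusp data -/

/-- Surjectivity of `B⁻¹ ∘ D ∘ A` for invertible `A`, `B`. [folklore] -/
private theorem surjective_equiv_comp_iff {E₁ E₂ F₁ F₂ : Type*} [NormedAddCommGroup E₁]
    [NormedSpace ℝ E₁] [NormedAddCommGroup E₂] [NormedSpace ℝ E₂] [NormedAddCommGroup F₁]
    [NormedSpace ℝ F₁] [NormedAddCommGroup F₂] [NormedSpace ℝ F₂] (A : E₁ ≃L[ℝ] E₂)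
    (B : F₂ ≃L[ℝ] F₁) (D : E₂ →L[ℝ] F₂) :
    Surjective ((B : F₂ →L[ℝ] F₁).comp (D.comp (A : E₁ →L[ℝ] E₂))) ↔ Surjective D := by
  constructor
  · intro hs
    have h1 : Surjective (⇑B ∘ (⇑D ∘ ⇑A)) := hs
    exact (h1.of_comp_left B.injective).of_comp
  · intro hD
    exact B.surjective.comp (hD.comp A.surjective)

/-- **Near a point with Whitney cusp data, every other critical point is a fold point.**
[cite: GolubitskyGuillemin1973, Ch. VI §2] [cite: BaykurSaeki2017, §2.1, p. 6] -/
theorem HasWhitneyCuspData.eventually_isFoldPointAt {F : 𝔼 4 → 𝔼 2} {p : 𝔼 4}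
    (hW : HasWhitneyCuspData F p) :
    ∀ᶠ q in 𝓝 p, q ≠ p → ¬ Surjective (fderiv ℝ F q) → OneJet.IsFoldPointAt F q := by
  obtain ⟨φ, ψ, h, U, ε₂, ε₃, hpφ, hp0, hmaps, hφ, hφs, hψ, hψs, hU, hh, hφU, hε₂, hε₃, hid,
    -, -, hx, hxx, hxxx, htx⟩ := hW
  have hε₂0 : ε₂ ≠ 0 := by rintro rfl; norm_num at hε₂
  have hε₃0 : ε₃ ≠ 0 := by rintro rfl; norm_num at hε₃
  have h0U : (0 : ℝ × ℝ) ∈ U := by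
    have := hφU p hpφ
    rw [hp0] at this
    exact (by simpa using this : ((0 : ℝ), (0 : ℝ)) ∈ U)
  set G : 𝔼 4 → 𝔼 2 := OneJet.rankOneMap (OneJet.cuspModelFn h ε₂ ε₃) with hG
  set Ω : Set (𝔼 4) := OneJet.baseProj ⁻¹' U with hΩ
  have hΩo : IsOpen Ω := hU.preimage OneJet.baseProj.continuous
  have hGs : ContDiffOn ℝ ∞ G Ω := OneJet.contDiffOn_rankOneMap (OneJet.contDiffOn_cuspModelFn hh ε₂ ε₃)
  have hφΩ : ∀ q ∈ φ.source, φ q ∈ Ω := fun q hq => hφU q hq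
  -- the chart identity as an identity of vectors, and `F = ψ⁻¹ ∘ G ∘ φ` on `φ.source`
  have hidv : ∀ q ∈ φ.source, ψ (F q) = G (φ q) := by
    intro q hq
    obtain ⟨h0', h1'⟩ := hid q hq
    ext i
    fin_cases i
    · show ψ (F q) 0 = OneJet.rankOneMap _ (φ q) 0
      rw [OneJet.rankOneMap_apply_zero, h0']
    · show ψ (F q) 1 = OneJet.rankOneMap _ (φ q) 1
      rw [OneJet.rankOneMap_apply_one, h1']
      rfl
  have hev : ∀ q ∈ φ.source, F =ᶠ[𝓝 q] (ψ.symm ∘ G) ∘ φ := by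
    intro q hq
    filter_upwards [φ.open_source.mem_nhds hq] with q' hq'
    show F q' = ψ.symm (G (φ q'))
    rw [← hidv q' hq', ψ.left_inv (hmaps hq')]
  -- transfer of criticality and of the fold condition at every point of `φ.source`
  have h2 : (2 : WithTop ℕ∞) ≤ ∞ := coe_le_infty 2
  have htransfer : ∀ q ∈ φ.source,
      (Surjective (fderiv ℝ F q) ↔ Surjective (fderiv ℝ G (φ q))) ∧
        (OneJet.IsFoldPointAt F q ↔ OneJet.IsFoldPointAt G (φ q)) := by
    intro q hq
    obtain ⟨A, hA, -⟩ := exists_fderiv_continuousLinearEquiv φ hφ hφs (by simp) hq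
    have hFq : F q ∈ ψ.source := hmaps hq
    obtain ⟨B, -, hBs⟩ := exists_fderiv_continuousLinearEquiv ψ hψ hψs (by simp) hFq
    have hGq : G (φ q) = ψ (F q) := (hidv q hq).symm
    have hBs' : HasFDerivAt ψ.symm (B.symm : 𝔼 2 →L[ℝ] 𝔼 2) (G (φ q)) := by
      rw [hGq]
      exact hBs
    have hφ2 : ContDiffAt ℝ 2 φ q := (hφ.contDiffAt (φ.open_source.mem_nhds hq)).of_le h2
    have hGc : ContDiffAt ℝ ∞ G (φ q) := hGs.contDiffAt (hΩo.mem_nhds (hφΩ q hq))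
    have hG2 : ContDiffAt ℝ 2 G (φ q) := hGc.of_le h2
    have hψs2 : ContDiffAt ℝ 2 ψ.symm (G (φ q)) := by
      rw [hGq]
      exact (hψs.contDiffAt (ψ.open_target.mem_nhds (ψ.map_source hFq))).of_le h2
    have hψG2 : ContDiffAt ℝ 2 (ψ.symm ∘ G) (φ q) := hψs2.comp (φ q) hG2
    have hGd : HasFDerivAt G (fderiv ℝ G (φ q)) (φ q) := (hGc.differentiableAt (by simp)).hasFDerivAt
    have hFd : HasFDerivAt F ((B.symm : 𝔼 2 →L[ℝ] 𝔼 2).comp ((fderiv ℝ G (φ q)).comp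
        (A : 𝔼 4 →L[ℝ] 𝔼 4))) q :=
      ((hBs'.comp (φ q) hGd).comp q hA).congr_of_eventuallyEq (hev q hq)
    refine ⟨?_, ?_⟩
    · rw [hFd.fderiv]
      exact surjective_equiv_comp_iff A B.symm (fderiv ℝ G (φ q))
    · rw [OneJet.isFoldPointAt_congr_of_eventuallyEq (hev q hq),
        OneJet.isFoldPointAt_comp_iff A hA hφ2 hψG2,
        OneJet.isFoldPointAt_comp_target_iff B.symm hBs' hψs2 hG2]
  -- the planar lemma, pulled back along `q ↦ ((φ q)₀, (φ q)₁)`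
  have hplane := eventually_eq_zero_of_whitney hU h0U hh hx hxx hxxx htx
  have htend : Tendsto (fun q => OneJet.baseProj (φ q)) (𝓝 p) (𝓝 0) := by
    have h1 : Tendsto φ (𝓝 p) (𝓝 (φ p)) := φ.continuousAt hpφ
    rw [hp0] at h1
    have h2 := OneJet.baseProj.continuous.continuousAt.tendsto.comp h1
    rwa [map_zero] at h2
  filter_upwards [htend.eventually hplane, φ.open_source.mem_nhds hpφ] with q hq hqs hqp hcrit
  have hy : φ q ∈ Ω := hφΩ q hqs
  have hcritG : ¬ Surjective (fderiv ℝ G (φ q)) := by rwa [← (htransfer q hqs).1]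
  obtain ⟨h1, h2', h3'⟩ := (critical_cuspModel_iff hU hh hy).1 hcritG
  have hy2 : φ q 2 = 0 := (mul_eq_zero.1 h2').resolve_left hε₂0
  have hy3 : φ q 3 = 0 := (mul_eq_zero.1 h3').resolve_left hε₃0
  have hxxq : fderiv ℝ (fderiv ℝ h) (φ q 0, φ q 1) ((0 : ℝ), (1 : ℝ)) ((0 : ℝ), (1 : ℝ)) ≠ 0 := by
    intro hzero
    have h01 : ((φ q) 0, (φ q) 1) = 0 := hq h1 hzero
    have hφq : φ q = 0 := by
      ext i
      fin_cases i
      · simpa using congrArg Prod.fst h01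
      · simpa using congrArg Prod.snd h01
      · simpa using hy2
      · simpa using hy3
    exact hqp (φ.injOn hqs hpφ (by rw [hφq, hp0]))
  exact (htransfer q hqs).2.2 (isFoldPointAt_cuspModel hU hh hε₂0 hε₃0 hy hcritG hxxq)

end Literature.Topology.FourManifolds
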